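import Literature.AlgebraicGeometry.Motives.HodgeThetaSubalgebraSymplecticRankSix
import HarnessLib

/-!
# A non-zero ideal of `𝔰𝔭(M, ω)` contains the Lagrangian grading operator (the simplicity mechanism of the
# symplectic Lie algebra, in the Siegel block form), and its Hodge form: a non-zero `𝔰𝔭(V_ℂ, ψ_ℂ)`-stable space
# of skew operators of a polarized weight-one Hodge structure contains `Θ`

Family `hodge`, layer `Literature/AlgebraicGeometry/Motives`. Research context: cell `pub-hodge-ring2` (HONEST
FRAMING: research route conditional on HC_CM; not a corollary; Q11.4-sentence-2 already refuted in dim ≥ 3),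
Literature lane, programme R14 «generic × generic products» (Hazama 1989 / Moonen–Zarhin 1999 Thm. (3.2)(1):
`Hg(X₁ × X₂) = Hg(X₁) × Hg(X₂)` for factors without type IV and `Hom(X₁, X₂) = 0`), the abstract Lie step,
PART 1. UNCONDITIONAL linear algebra over `ℂ`; theorems only, no definition, no named fact (D-0026), no `sorry`.
It supplies the GOURSAT INPUT of the product theorem `HodgeThetaAnnihilatorRealBlocksTimesSymplectic` (PART 2):
the kernel of the first corner map of the annihilator algebra of a Hodge class on `X₁ × X₂` projects to an IDEAL
of `𝔰𝔭(H¹(X₂))`, and this file shows that such an ideal, once non-zero, contains the Hodge operator `Θ₂`, so that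
the `Θ`-subalgebra theorems of the tree (`HodgeThetaSubalgebraSymplecticRankFour`, `…RankSixHodge`) make it
everything — the Lie-algebra form of «`𝔰𝔭_{2g}` is simple», which is what Hazama's Goursat argument uses
(Moonen–Zarhin 1999 (3.1): `hg(X₁ × X₂) = 𝔤₁ ⊕ 𝔤₂ ⊕ Γ_φ` with `Γ_φ` the graph of an isomorphism of IDEALS).

SETTING (Goodman–Wallach §2.1.2, the Siegel block form `𝔰𝔭(M, ω) = 𝔲⁻ ⊕ 𝔤𝔩(P) ⊕ 𝔲⁺`). `ω` a nondegenerate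
alternating form on a finite-dimensional complex space `M`; `T` an `ω`-skew involution (`T² = 1`) with
eigenspaces `P` (`+1`) and `Q` (`−1`) — automatically Lagrangian and in perfect `ω`-duality; `I ⊆ End(M)` a
`ℂ`-subspace of `ω`-skew operators with `[Z, I] ⊆ I` for EVERY `ω`-skew `Z` (an ideal of `𝔰𝔭(M, ω)`).

* §1 The rank-two skew operators `Y_{a,b} = ω(a, ·) ⊗ b + ω(b, ·) ⊗ a` (`SymplecticIdeal.pairOp_apply`,
  `pairOp_skew`); for `p, p' ∈ P`, `q, q' ∈ Q` the `𝔤𝔩(P)`-COMMUTATION RULE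
  `[Y_{p,q}, Y_{p',q'}] = ω(p,q') Y_{p',q} − ω(p',q) Y_{p,q'}` (`pairOp_bracket`; `Y_{p,q}|_P = −q^∨ ⊗ … `, i.e.
  `Y_{p,q}` is the Levi element with `P`-restriction `x ↦ −ω(x,q) p`… written `ω(q,x) p`), and the expansion
  `T = −∑_i Y_{b_i, q_i}` along a basis `b` of `P` and its `ω`-dual family `q` in `Q` (`theta_eq_neg_sum_pairOp`).
* §2 GENERATION (`pairOp_mem_of_unit`): if `Y_{p₀,q₀} ∈ I` with `ω(p₀, q₀) = 1` then every `Y_{p,q} ∈ I`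
  (`p ∈ P`, `q ∈ Q`): three brackets (`[Y_{p₀,q'}, Y_{p₀,q₀}] = Y_{p₀,q'}` for `q' ⊥ p₀`,
  `[Y_{p',q₀}, Y_{p₀,q₀}] = −Y_{p',q₀}` for `p' ⊥ q₀`, `[Y_{p',q₀}, Y_{p₀,q'}] = ω(p',q') Y_{p₀,q₀} − Y_{p',q'}`)
  and bilinearity — the computation behind «a rank-one idempotent generates `𝔤𝔩(P)` as an ideal»
  (Jacobson; the tree's `SymplecticThetaSix.eq_top_of_rankOne_idempotent` is the subalgebra version); hence
  `T ∈ I` (`theta_mem_of_unit`).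
* §3 `theta_mem_of_plus`: a non-zero `B ∈ I ∩ 𝔲⁺` (kills `P`, values in `P`) gives such a unit pair — the
  symmetric form `ω(B ·, ·)` on `Q` has a non-isotropic `q₀` (polarization; else `B = 0` by duality), and with
  the rank-one skew `C = ω(q₀, ·) ⊗ q₀ ∈ 𝔲⁻` one has `[B, C] = Y_{Bq₀, q₀}` with `ω(Bq₀, q₀) ≠ 0`.
  `exists_plus_of_levi`: a non-zero skew `Y` preserving `P` and `Q` has a non-zero bracket with some
  `ω(p₁, ·) ⊗ p₁ ∈ 𝔲⁺` (else every `p₁` is an eigenvector with eigenvalue forced to vanish, and `Y = 0` by duality).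
* §4 THE THEOREM `SymplecticIdeal.theta_mem_of_ne_bot`: `I ≠ 0 ⟹ T ∈ I` (grade a non-zero `Y ∈ I` by `ad T`:
  `Y_± = ¼(Y ± TY ∓ YT − TYT) ∈ I`; a non-zero `Y₊` is §3; a non-zero `Y₋` is §3 for `(−T, Q, P)`; otherwise
  `Y = Y₀` is Levi and §3 produces a non-zero element of `I ∩ 𝔲⁺`).
* §5 HODGE FORM `SymplecticIdeal.theta_mem_of_ne_bot_hodge`: for an effective polarized weight-one `ℚ`-Hodge
  structure `(V, ψ)` with Hodge operator `Θ` (`= ±1` on `V^{1,0}`, `V^{0,1}`), every non-zero `ℂ`-subspace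
  `I ⊆ End(V_ℂ)` of `ψ_ℂ`-skew operators with `[Z, I] ⊆ I` for all `ψ_ℂ`-skew `Z` contains `Θ`
  (`UnitaryTheta.theta_facts`: `V^{1,0}`, `V^{0,1}` are the eigenspaces of the skew involution `Θ`).

## References

* [GoodmanWallachGTM255] R. Goodman, N. R. Wallach, *Symmetry, Representations, and Invariants*, GTM 255
  (2009), §1.1.2 (symplectic forms, dual bases), §2.1.2 (`𝔰𝔭` in block form), §2.5.3, §4.1.1.
* [Humphreys1972] J. E. Humphreys, *Introduction to Lie Algebras and Representation Theory* (1972), §1.2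
  (`𝔰𝔭_{2ℓ}` via root vectors), §19.1.
* [MoonenZarhin1999LowDim] B. Moonen, Yu. Zarhin, *Hodge classes on abelian varieties of low dimension*, Math.
  Ann. 315 (1999) 711–733 = arXiv:math/9901113, §3 (3.1) (`hg(X₁ × X₂) ≅ 𝔤₁ ⊕ 𝔤₂ ⊕ Γ_φ`) and Thm. (3.2)(1)
  (Hazama) [corpus: paper:arxiv-math_9901113 p. 6].
* [Hazama1989] F. Hazama, *Algebraic cycles on nonsimple abelian varieties*, Duke Math. J. 58 (1989) 31–37
  (= Gordon's survey Thm. 7.6.2).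
* [VoisinHodgeI2002] C. Voisin, *Hodge Theory and Complex Algebraic Geometry I*, §7.1.2 Def. 7.7 (polarization).
-/

noncomputable section

open scoped TensorProduct

namespace Literature.AlgebraicGeometry.Motives

namespace HodgeStructure

/-! ### §1 The rank-two skew operators `Y_{a,b}` and the Siegel data of a skew involution -/

section PairOps

variable {M : Type*} [AddCommGroup M] [Module ℂ M]

/-- `Y_{a,b} v = ω(a,v) b + ω(b,v) a`. [cite: GoodmanWallachGTM255, §2.1.2] -/
theorem SymplecticIdeal.pairOp_apply (ω : LinearMap.BilinForm ℂ M) (a b v : M) :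
    ((ω a).smulRight b + (ω b).smulRight a) v = ω a v • b + ω b v • a := by
  simp only [LinearMap.add_apply, LinearMap.smulRight_apply]

/-- `Y_{a,b}` is `ω`-skew for `ω` alternating. [cite: GoodmanWallachGTM255, §2.1.2] -/
theorem SymplecticIdeal.pairOp_skew (ω : LinearMap.BilinForm ℂ M) (hωalt : ∀ x y, ω x y = -ω y x)
    (a b x y : M) :
    ω (((ω a).smulRight b + (ω b).smulRight a) x) y + ω x (((ω a).smulRight b + (ω b).smulRight a) y) = 0 := by
  simp only [LinearMap.add_apply, LinearMap.smulRight_apply, map_add, map_smul, LinearMap.smul_apply,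
    smul_eq_mul]
  rw [hωalt x b, hωalt x a]
  ring

/-- The rank-one operator `ω(a, ·) ⊗ a` is `ω`-skew for `ω` alternating (a root vector of `𝔲^±`).
[cite: GoodmanWallachGTM255, §2.1.2] -/
theorem SymplecticIdeal.smulRight_self_skew (ω : LinearMap.BilinForm ℂ M) (hωalt : ∀ x y, ω x y = -ω y x)
    (a x y : M) : ω (((ω a).smulRight a) x) y + ω x (((ω a).smulRight a) y) = 0 := by
  simp only [LinearMap.smulRight_apply, map_smul, LinearMap.smul_apply, smul_eq_mul]
  rw [hωalt x a]
  ring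

/-- **The `𝔤𝔩(P)`-commutation rule.** For `ω`-isotropic `P`, `Q` and `p, p' ∈ P`, `q, q' ∈ Q`:
`[Y_{p,q}, Y_{p',q'}] = ω(p,q') Y_{p',q} − ω(p',q) Y_{p,q'}` (matrix units of `𝔤𝔩(P)` in the Levi of the Siegel
parabolic). [cite: GoodmanWallachGTM255, §2.1.2] [cite: Humphreys1972, §1.2] -/
theorem SymplecticIdeal.pairOp_bracket (ω : LinearMap.BilinForm ℂ M) (hωalt : ∀ x y, ω x y = -ω y x)
    {P Q : Submodule ℂ M} (hPP : ∀ p ∈ P, ∀ p' ∈ P, ω p p' = 0) (hQQ : ∀ q ∈ Q, ∀ q' ∈ Q, ω q q' = 0)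
    {p p' q q' : M} (hp : p ∈ P) (hp' : p' ∈ P) (hq : q ∈ Q) (hq' : q' ∈ Q) :
    ((ω p).smulRight q + (ω q).smulRight p) * ((ω p').smulRight q' + (ω q').smulRight p') -
        ((ω p').smulRight q' + (ω q').smulRight p') * ((ω p).smulRight q + (ω q).smulRight p) =
      ω p q' • ((ω p').smulRight q + (ω q).smulRight p') - ω p' q • ((ω p).smulRight q' + (ω q').smulRight p) := by
  apply LinearMap.ext
  intro v
  have h1 : ω q p' = -ω p' q := hωalt q p'
  have h2 : ω q' p = -ω p q' := hωalt q' p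
  simp only [LinearMap.sub_apply, Module.End.mul_apply, LinearMap.smul_apply, LinearMap.add_apply,
    LinearMap.smulRight_apply, map_add, map_smul, hPP p hp p' hp', hPP p' hp' p hp,
    hQQ q hq q' hq', hQQ q' hq' q hq, h1, h2]
  module

/-- **Isotropy of the eigenspaces of a skew involution**: `ω(p, p') = 0` on the `+1`-eigenspace.
[cite: GoodmanWallachGTM255, §2.1.2] -/
theorem SymplecticIdeal.isotropic_of_skew_involution (ω : LinearMap.BilinForm ℂ M) {T : Module.End ℂ M}
    (hTskew : ∀ x y, ω (T x) y + ω x (T y) = 0) {P : Submodule ℂ M} (hP : ∀ x ∈ P, T x = x)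
    (p : M) (hp : p ∈ P) (p' : M) (hp' : p' ∈ P) : ω p p' = 0 := by
  have h := hTskew p p'
  rw [hP p hp, hP p' hp', ← two_smul ℂ (ω p p'), smul_eq_zero] at h
  exact h.resolve_left (two_ne_zero' ℂ)

/-- The `−1`-eigenspace is isotropic too (apply the previous lemma to `−T`). [cite: GoodmanWallachGTM255, §2.1.2] -/
theorem SymplecticIdeal.isotropic_of_skew_involution_neg (ω : LinearMap.BilinForm ℂ M) {T : Module.End ℂ M}
    (hTskew : ∀ x y, ω (T x) y + ω x (T y) = 0) {Q : Submodule ℂ M} (hQ : ∀ x ∈ Q, T x = -x)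
    (q : M) (hq : q ∈ Q) (q' : M) (hq' : q' ∈ Q) : ω q q' = 0 := by
  have h := hTskew q q'
  rw [hQ q hq, hQ q' hq', map_neg, LinearMap.neg_apply, map_neg, ← neg_add, neg_eq_zero,
    ← two_smul ℂ (ω q q'), smul_eq_zero] at h
  exact h.resolve_left (two_ne_zero' ℂ)

/-- **Duality of the Lagrangian pair, `P`-side**: an element of `P` that is `ω`-orthogonal to `Q` vanishes
(`M = P + Q`, `P` isotropic, `ω` nondegenerate). [cite: GoodmanWallachGTM255, §1.1.2 and §2.1.2] -/
theorem SymplecticIdeal.eq_zero_of_forall_Q (ω : LinearMap.BilinForm ℂ M) (hωnd : ω.Nondegenerate)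
    {T : Module.End ℂ M} (hTskew : ∀ x y, ω (T x) y + ω x (T y) = 0) {P Q : Submodule ℂ M}
    (hP : ∀ x ∈ P, T x = x) (hPmem : ∀ v, (2 : ℂ)⁻¹ • (v + T v) ∈ P)
    (hQmem : ∀ v, (2 : ℂ)⁻¹ • (v - T v) ∈ Q) {x : M} (hx : x ∈ P) (hxQ : ∀ q ∈ Q, ω x q = 0) : x = 0 := by
  refine hωnd.1 x fun v => ?_
  have hv : (2 : ℂ)⁻¹ • (v + T v) + (2 : ℂ)⁻¹ • (v - T v) = v := by module
  rw [← hv, map_add, SymplecticIdeal.isotropic_of_skew_involution ω hTskew hP x hx _ (hPmem v),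
    hxQ _ (hQmem v), add_zero]

/-- **Duality of the Lagrangian pair, `Q`-side**: an element of `Q` that is `ω`-orthogonal to `P` vanishes.
[cite: GoodmanWallachGTM255, §1.1.2 and §2.1.2] -/
theorem SymplecticIdeal.eq_zero_of_forall_P (ω : LinearMap.BilinForm ℂ M) (hωnd : ω.Nondegenerate)
    (hωalt : ∀ x y, ω x y = -ω y x) {T : Module.End ℂ M} (hTskew : ∀ x y, ω (T x) y + ω x (T y) = 0)
    {P Q : Submodule ℂ M} (hQ : ∀ x ∈ Q, T x = -x) (hPmem : ∀ v, (2 : ℂ)⁻¹ • (v + T v) ∈ P)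
    (hQmem : ∀ v, (2 : ℂ)⁻¹ • (v - T v) ∈ Q) {y : M} (hy : y ∈ Q) (hyP : ∀ p ∈ P, ω p y = 0) : y = 0 := by
  refine hωnd.1 y fun v => ?_
  have hv : (2 : ℂ)⁻¹ • (v + T v) + (2 : ℂ)⁻¹ • (v - T v) = v := by module
  rw [← hv, map_add, hωalt y, hyP _ (hPmem v), neg_zero, zero_add,
    SymplecticIdeal.isotropic_of_skew_involution_neg ω hTskew hQ y hy _ (hQmem v)]

/-- **`T = −∑_i Y_{b_i, q_i}`** for a basis `b` of `P` and an `ω`-dual family `q_i ∈ Q` (`ω(b_j, q_i) = δ_{ji}`):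
both sides are `ω`-orthogonal-tested against `M = P + Q`. [cite: GoodmanWallachGTM255, §1.1.2 and §2.1.2] -/
theorem SymplecticIdeal.theta_eq_neg_sum_pairOp [FiniteDimensional ℂ M] (ω : LinearMap.BilinForm ℂ M)
    (hωnd : ω.Nondegenerate) (hωalt : ∀ x y, ω x y = -ω y x) {T : Module.End ℂ M}
    (hTskew : ∀ x y, ω (T x) y + ω x (T y) = 0) {P Q : Submodule ℂ M}
    (hP : ∀ x ∈ P, T x = x) (hQ : ∀ x ∈ Q, T x = -x) (hPmem : ∀ v, (2 : ℂ)⁻¹ • (v + T v) ∈ P)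
    (hQmem : ∀ v, (2 : ℂ)⁻¹ • (v - T v) ∈ Q) {ι : Type*} [Fintype ι] (b : Module.Basis ι ℂ ↥P)
    {q : ι → M} (hqQ : ∀ i, q i ∈ Q) (hq : ∀ i j, ω (b j : M) (q i) = b.coord i (b j)) :
    T = -∑ i, ((ω (b i : M)).smulRight (q i) + (ω (q i)).smulRight (b i : M)) := by
  classical
  have hPP := SymplecticIdeal.isotropic_of_skew_involution ω hTskew hP
  have hQQ := SymplecticIdeal.isotropic_of_skew_involution_neg ω hTskew hQ
  have hq' : ∀ i j, ω (b j : M) (q i) = if j = i then 1 else 0 := fun i j => by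
    rw [hq, Module.Basis.coord_apply, Module.Basis.repr_self, Finsupp.single_apply]
  -- expansion of elements of `P` along `b` via the dual family
  have hexpandP : ∀ x ∈ P, x = ∑ i, ω x (q i) • (b i : M) := by
    intro x hx
    have h1 : x = ∑ i, b.repr ⟨x, hx⟩ i • (b i : M) := by
      have h := congrArg Subtype.val (b.sum_repr ⟨x, hx⟩)
      simp only [Submodule.coe_sum, Submodule.coe_smul] at h
      exact h.symm
    have h2 : ∀ i, ω x (q i) = b.repr ⟨x, hx⟩ i := fun i => by
      conv_lhs => rw [h1]
      simp only [map_sum, map_smul, LinearMap.sum_apply, LinearMap.smul_apply, smul_eq_mul, hq']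
      rw [Finset.sum_eq_single i]
      · rw [if_pos rfl, mul_one]
      · intro j _ hji
        rw [if_neg hji, mul_zero]
      · intro hi
        exact absurd (Finset.mem_univ i) hi
    conv_lhs => rw [h1]
    exact Finset.sum_congr rfl fun i _ => by rw [h2 i]
  -- test the difference against `ω(·, w)`, `w ∈ P + Q`
  set S : Module.End ℂ M := ∑ i, ((ω (b i : M)).smulRight (q i) + (ω (q i)).smulRight (b i : M)) with hS
  have hSapply : ∀ v, S v = ∑ i, (ω (b i : M) v • q i + ω (q i) v • (b i : M)) := fun v => by
    rw [hS, LinearMap.sum_apply]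
    exact Finset.sum_congr rfl fun i _ => SymplecticIdeal.pairOp_apply ω _ _ v
  have hSP : ∀ p ∈ P, S p = -p := by
    intro p hp
    rw [hSapply]
    have h : ∀ i, ω (b i : M) p • q i + ω (q i) p • (b i : M) = -(ω p (q i) • (b i : M)) := fun i => by
      rw [hPP _ (b i).2 p hp, zero_smul, zero_add, hωalt (q i) p, neg_smul]
    simp only [h, Finset.sum_neg_distrib]
    rw [← hexpandP p hp]
  have hSQ : ∀ y ∈ Q, S y = y := by
    intro y hy
    rw [hSapply]
    have h : ∀ i, ω (b i : M) y • q i + ω (q i) y • (b i : M) = ω (b i : M) y • q i := fun i => by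
      rw [hQQ _ (hqQ i) y hy, zero_smul, add_zero]
    simp only [h]
    -- `∑ ω(b_i, y) q_i - y ∈ Q` is `ω`-orthogonal to `P`
    have hmem : (∑ i, ω (b i : M) y • q i) - y ∈ Q :=
      Submodule.sub_mem _ (Submodule.sum_mem _ fun i _ => Submodule.smul_mem _ _ (hqQ i)) hy
    have hzero := SymplecticIdeal.eq_zero_of_forall_P ω hωnd hωalt hTskew hQ hPmem hQmem hmem fun p hp => by
      rw [map_sub, map_sum]
      simp only [map_smul, smul_eq_mul]
      conv_lhs => rw [hexpandP p hp]
      simp only [map_sum, map_smul, LinearMap.sum_apply, LinearMap.smul_apply, smul_eq_mul, hq']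
      rw [sub_eq_zero]
      refine Finset.sum_congr rfl fun i _ => ?_
      rw [Finset.sum_eq_single i]
      · rw [if_pos rfl, mul_one, mul_comm]
      · intro j _ hji
        rw [if_neg hji, mul_zero]
      · intro hi
        exact absurd (Finset.mem_univ i) hi
    exact (sub_eq_zero.1 hzero)
  apply LinearMap.ext
  intro v
  have hv : (2 : ℂ)⁻¹ • (v + T v) + (2 : ℂ)⁻¹ • (v - T v) = v := by module
  rw [LinearMap.neg_apply, ← hv, map_add, map_add, hP _ (hPmem v), hQ _ (hQmem v), hSP _ (hPmem v),
    hSQ _ (hQmem v), neg_add, neg_neg]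

/-! ### §2 Generation: a unit pair operator in the ideal gives all `Y_{p,q}`, hence `T` -/

/-- **Generation.** Let `I ⊆ End(M)` be a subspace with `[Z, I] ⊆ I` for every `ω`-skew `Z`, `P`, `Q`
isotropic, and suppose `Y_{p₀,q₀} ∈ I` for some `p₀ ∈ P`, `q₀ ∈ Q` with `ω(p₀, q₀) = 1`. Then `Y_{p,q} ∈ I` for
all `p ∈ P`, `q ∈ Q`: `[Y_{p₀,q'}, Y_{p₀,q₀}] = Y_{p₀,q'}` (`q' ⊥ p₀`), `[Y_{p',q₀}, Y_{p₀,q₀}] = −Y_{p',q₀}`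
(`p' ⊥ q₀`), `[Y_{p',q₀}, Y_{p₀,q'}] = ω(p',q') Y_{p₀,q₀} − Y_{p',q'}`, and `Y` is bilinear (the ideal of `𝔤𝔩(P)`
generated by a rank-one idempotent is everything). [cite: GoodmanWallachGTM255, §2.1.2 and §4.1.1]
[cite: Humphreys1972, §19.1] -/
theorem SymplecticIdeal.pairOp_mem_of_unit (ω : LinearMap.BilinForm ℂ M) (hωalt : ∀ x y, ω x y = -ω y x)
    {P Q : Submodule ℂ M} (hPP : ∀ p ∈ P, ∀ p' ∈ P, ω p p' = 0) (hQQ : ∀ q ∈ Q, ∀ q' ∈ Q, ω q q' = 0)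
    (I : Submodule ℂ (Module.End ℂ M))
    (hI : ∀ Z : Module.End ℂ M, (∀ x y, ω (Z x) y + ω x (Z y) = 0) → ∀ Y ∈ I, Z * Y - Y * Z ∈ I)
    {p₀ q₀ : M} (hp₀ : p₀ ∈ P) (hq₀ : q₀ ∈ Q) (hunit : ω p₀ q₀ = 1)
    (hmem : (ω p₀).smulRight q₀ + (ω q₀).smulRight p₀ ∈ I) {p q : M} (hp : p ∈ P) (hq : q ∈ Q) :
    (ω p).smulRight q + (ω q).smulRight p ∈ I := by
  have hbr := fun {a a' c c' : M} (ha : a ∈ P) (ha' : a' ∈ P) (hc : c ∈ Q) (hc' : c' ∈ Q) =>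
    SymplecticIdeal.pairOp_bracket ω hωalt hPP hQQ ha ha' hc hc'
  have hskew := fun a c : M => SymplecticIdeal.pairOp_skew ω hωalt a c
  -- (i) `q' ⊥ p₀`
  have h1 : ∀ q' ∈ Q, ω p₀ q' = 0 → (ω p₀).smulRight q' + (ω q').smulRight p₀ ∈ I := by
    intro q' hq' h0
    have h := hI _ (hskew p₀ q') _ hmem
    rw [hbr hp₀ hp₀ hq' hq₀, hunit, one_smul, h0, zero_smul, sub_zero] at h
    exact h
  -- (ii) `p' ⊥ q₀`
  have h2 : ∀ p' ∈ P, ω p' q₀ = 0 → (ω p').smulRight q₀ + (ω q₀).smulRight p' ∈ I := by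
    intro p' hp' h0
    have h := hI _ (hskew p' q₀) _ hmem
    rw [hbr hp' hp₀ hq₀ hq₀, h0, zero_smul, hunit, one_smul, zero_sub] at h
    exact (Submodule.neg_mem_iff _).1 h
  -- (iii) both orthogonal
  have h3 : ∀ p' ∈ P, ω p' q₀ = 0 → ∀ q' ∈ Q, ω p₀ q' = 0 →
      (ω p').smulRight q' + (ω q').smulRight p' ∈ I := by
    intro p' hp' hp'0 q' hq' hq'0
    have h := hI _ (hskew p' q₀) _ (h1 q' hq' hq'0)
    rw [hbr hp' hp₀ hq₀ hq', hunit, one_smul] at h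
    -- `h : ω p' q' • Y₀₀ - Y_{p',q'} ∈ I`
    have h' := Submodule.sub_mem _ (Submodule.smul_mem _ (ω p' q') hmem) h
    rwa [sub_sub_cancel] at h'
  -- (iv) bilinear expansion of `Y_{p,q}`
  have hexp : ∀ (a c : ℂ) (x y : M),
      (ω (x + a • p₀)).smulRight (y + c • q₀) + (ω (y + c • q₀)).smulRight (x + a • p₀) =
        ((ω x).smulRight y + (ω y).smulRight x) + c • ((ω x).smulRight q₀ + (ω q₀).smulRight x) +
          a • ((ω p₀).smulRight y + (ω y).smulRight p₀) +
          (a * c) • ((ω p₀).smulRight q₀ + (ω q₀).smulRight p₀) := by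
    intro a c x y
    apply LinearMap.ext
    intro v
    simp only [LinearMap.add_apply, LinearMap.smul_apply, LinearMap.smulRight_apply, map_add, map_smul,
      smul_eq_mul, smul_add, add_smul, smul_smul]
    module
  set a : ℂ := ω p q₀ with ha
  set c : ℂ := ω p₀ q with hc
  set p' : M := p - a • p₀ with hp'
  set q' : M := q - c • q₀ with hq'
  have hp'P : p' ∈ P := Submodule.sub_mem _ hp (Submodule.smul_mem _ _ hp₀)
  have hq'Q : q' ∈ Q := Submodule.sub_mem _ hq (Submodule.smul_mem _ _ hq₀)
  have hp'0 : ω p' q₀ = 0 := by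
    rw [hp', map_sub, map_smul, LinearMap.sub_apply, LinearMap.smul_apply, hunit, smul_eq_mul, mul_one, ha, sub_self]
  have hq'0 : ω p₀ q' = 0 := by
    rw [hq', map_sub, map_smul, hunit, smul_eq_mul, mul_one, hc, sub_self]
  have hpeq : p = p' + a • p₀ := by rw [hp', sub_add_cancel]
  have hqeq : q = q' + c • q₀ := by rw [hq', sub_add_cancel]
  rw [hpeq, hqeq, hexp a c p' q']
  exact Submodule.add_mem _ (Submodule.add_mem _ (Submodule.add_mem _ (h3 p' hp'P hp'0 q' hq'Q hq'0)
    (Submodule.smul_mem _ _ (h2 p' hp'P hp'0))) (Submodule.smul_mem _ _ (h1 q' hq'Q hq'0)))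
    (Submodule.smul_mem _ _ hmem)

/-- **`T ∈ I` from a unit pair operator in `I`** (`T = −∑ Y_{b_i, q_i}`, all of which lie in `I`).
[cite: GoodmanWallachGTM255, §2.1.2] -/
theorem SymplecticIdeal.theta_mem_of_unit [FiniteDimensional ℂ M] (ω : LinearMap.BilinForm ℂ M)
    (hωnd : ω.Nondegenerate) (hωalt : ∀ x y, ω x y = -ω y x) {T : Module.End ℂ M}
    (hTskew : ∀ x y, ω (T x) y + ω x (T y) = 0) {P Q : Submodule ℂ M}
    (hP : ∀ x ∈ P, T x = x) (hQ : ∀ x ∈ Q, T x = -x) (hPmem : ∀ v, (2 : ℂ)⁻¹ • (v + T v) ∈ P)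
    (hQmem : ∀ v, (2 : ℂ)⁻¹ • (v - T v) ∈ Q) (I : Submodule ℂ (Module.End ℂ M))
    (hI : ∀ Z : Module.End ℂ M, (∀ x y, ω (Z x) y + ω x (Z y) = 0) → ∀ Y ∈ I, Z * Y - Y * Z ∈ I)
    {p₀ q₀ : M} (hp₀ : p₀ ∈ P) (hq₀ : q₀ ∈ Q) (hunit : ω p₀ q₀ = 1)
    (hmem : (ω p₀).smulRight q₀ + (ω q₀).smulRight p₀ ∈ I) : T ∈ I := by
  classical
  have hPP := SymplecticIdeal.isotropic_of_skew_involution ω hTskew hP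
  have hQQ := SymplecticIdeal.isotropic_of_skew_involution_neg ω hTskew hQ
  have hdetP : ∀ x ∈ P, (∀ q ∈ Q, ω x q = 0) → x = 0 :=
    fun x hx hxQ => SymplecticIdeal.eq_zero_of_forall_Q ω hωnd hTskew hP hPmem hQmem hx hxQ
  have hdetQ : ∀ y ∈ Q, (∀ p ∈ P, ω p y = 0) → y = 0 :=
    fun y hy hyP => SymplecticIdeal.eq_zero_of_forall_P ω hωnd hωalt hTskew hQ hPmem hQmem hy hyP
  set b := Module.finBasis ℂ ↥P with hb
  obtain ⟨q, hqQ, hq⟩ := SymplecticThetaSix.exists_dual_family ω hdetP hdetQ b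
  rw [SymplecticIdeal.theta_eq_neg_sum_pairOp ω hωnd hωalt hTskew hP hQ hPmem hQmem b hqQ hq]
  exact Submodule.neg_mem _ (Submodule.sum_mem _ fun i _ =>
    SymplecticIdeal.pairOp_mem_of_unit ω hωalt hPP hQQ I hI hp₀ hq₀ hunit hmem (b i).2 (hqQ i))

/-! ### §3 A non-zero element of `I ∩ 𝔲⁺` gives a unit pair; a non-zero Levi element gives one of `I ∩ 𝔲⁺` -/

/-- **`T ∈ I` from a non-zero `B ∈ I ∩ 𝔲⁺`.** If `B ∈ I` is `ω`-skew, kills `P`, takes values in `P` and is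
non-zero, then `T ∈ I`: the symmetric form `ω(B ·, ·)` on `Q` has a non-isotropic vector `q₀` (otherwise it
vanishes by polarization and `B = 0` by the duality of `P` and `Q`), and for the skew rank-one `C = ω(q₀, ·) ⊗ q₀`
the bracket `[B, C] = Y_{B q₀, q₀}` lies in `I` with `ω(B q₀, q₀) ≠ 0`; §2 applies after rescaling `q₀`.
[cite: GoodmanWallachGTM255, §2.1.2 and §4.1.1] [cite: Humphreys1972, §1.2] -/
theorem SymplecticIdeal.theta_mem_of_plus [FiniteDimensional ℂ M] (ω : LinearMap.BilinForm ℂ M)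
    (hωnd : ω.Nondegenerate) (hωalt : ∀ x y, ω x y = -ω y x) {T : Module.End ℂ M}
    (hTskew : ∀ x y, ω (T x) y + ω x (T y) = 0) {P Q : Submodule ℂ M}
    (hP : ∀ x ∈ P, T x = x) (hQ : ∀ x ∈ Q, T x = -x) (hPmem : ∀ v, (2 : ℂ)⁻¹ • (v + T v) ∈ P)
    (hQmem : ∀ v, (2 : ℂ)⁻¹ • (v - T v) ∈ Q) (I : Submodule ℂ (Module.End ℂ M))
    (hI : ∀ Z : Module.End ℂ M, (∀ x y, ω (Z x) y + ω x (Z y) = 0) → ∀ Y ∈ I, Z * Y - Y * Z ∈ I)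
    {B : Module.End ℂ M} (hBI : B ∈ I) (hBskew : ∀ x y, ω (B x) y + ω x (B y) = 0)
    (hBP : ∀ p ∈ P, B p = 0) (hBim : ∀ v, B v ∈ P) (hB0 : B ≠ 0) : T ∈ I := by
  have hPP := SymplecticIdeal.isotropic_of_skew_involution ω hTskew hP
  have hQQ := SymplecticIdeal.isotropic_of_skew_involution_neg ω hTskew hQ
  have hdetP : ∀ x ∈ P, (∀ q ∈ Q, ω x q = 0) → x = 0 :=
    fun x hx hxQ => SymplecticIdeal.eq_zero_of_forall_Q ω hωnd hTskew hP hPmem hQmem hx hxQ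
  -- a non-isotropic vector for `ω(B ·, ·)` on `Q`
  have hex : ∃ q₀ ∈ Q, ω (B q₀) q₀ ≠ 0 := by
    by_contra hcon
    push Not at hcon
    have hpol : ∀ q ∈ Q, ∀ q' ∈ Q, ω (B q) q' = 0 := by
      intro q hq q' hq'
      have h := hcon (q + q') (Submodule.add_mem _ hq hq')
      simp only [map_add, LinearMap.add_apply, hcon q hq, hcon q' hq', zero_add, add_zero] at h
      -- `ω(Bq', q) = ω(Bq, q')`
      have h2 : ω (B q') q = ω (B q) q' := by
        have h3 := hBskew q' q
        rw [hωalt q' (B q)] at h3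
        linear_combination h3
      rw [h2, ← two_smul ℂ (ω (B q) q'), smul_eq_zero] at h
      exact h.resolve_left (two_ne_zero' ℂ)
    have hBQ : ∀ q ∈ Q, B q = 0 := fun q hq => hdetP _ (hBim q) fun q' hq' => hpol q hq q' hq'
    apply hB0
    apply LinearMap.ext
    intro v
    have hv : (2 : ℂ)⁻¹ • (v + T v) + (2 : ℂ)⁻¹ • (v - T v) = v := by module
    rw [LinearMap.zero_apply, ← hv, map_add, hBP _ (hPmem v), hBQ _ (hQmem v), add_zero]
  obtain ⟨q₀, hq₀, hσ⟩ := hex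
  set σ : ℂ := ω (B q₀) q₀ with hσdef
  set p₀ : M := B q₀ with hp₀def
  have hp₀ : p₀ ∈ P := hBim q₀
  -- the rank-one skew `C = ω(q₀, ·) ⊗ q₀` and the bracket `[B, C] = Y_{p₀, q₀}`
  have hCskew := SymplecticIdeal.smulRight_self_skew ω hωalt q₀
  have hmemBC : B * (ω q₀).smulRight q₀ - (ω q₀).smulRight q₀ * B ∈ I := by
    have h := hI _ hCskew B hBI
    rw [← neg_sub] at h
    exact (Submodule.neg_mem_iff _).1 h
  have hBC : B * (ω q₀).smulRight q₀ - (ω q₀).smulRight q₀ * B = (ω p₀).smulRight q₀ + (ω q₀).smulRight p₀ := by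
    apply LinearMap.ext
    intro v
    have h1 : ω q₀ (B v) = -ω p₀ v := by
      have h := hBskew q₀ v
      rw [hp₀def]
      linear_combination h
    simp only [LinearMap.sub_apply, Module.End.mul_apply, LinearMap.smulRight_apply, LinearMap.add_apply, map_smul,
      h1, neg_smul, sub_neg_eq_add, hp₀def]
    rw [add_comm]
  rw [hBC] at hmemBC
  -- rescale `q₀` to get a unit pair
  have hunit : ω p₀ (σ⁻¹ • q₀) = 1 := by
    rw [map_smul, smul_eq_mul, hσdef, hp₀def, inv_mul_cancel₀ hσ]
  have hmem' : (ω p₀).smulRight (σ⁻¹ • q₀) + (ω (σ⁻¹ • q₀)).smulRight p₀ ∈ I := by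
    have h : (ω p₀).smulRight (σ⁻¹ • q₀) + (ω (σ⁻¹ • q₀)).smulRight p₀ =
        σ⁻¹ • ((ω p₀).smulRight q₀ + (ω q₀).smulRight p₀) := by
      apply LinearMap.ext
      intro v
      simp only [LinearMap.add_apply, LinearMap.smul_apply, LinearMap.smulRight_apply, map_smul, smul_eq_mul,
        smul_add, smul_smul, mul_comm (ω p₀ v) σ⁻¹]
    rw [h]
    exact Submodule.smul_mem _ _ hmemBC
  exact SymplecticIdeal.theta_mem_of_unit ω hωnd hωalt hTskew hP hQ hPmem hQmem I hI hp₀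
    (Submodule.smul_mem _ _ hq₀) hunit hmem'

/-- **A non-zero Levi element moves some root vector of `𝔲⁺`.** If `Y ≠ 0` is `ω`-skew and preserves `P` and
`Q`, then `[Y, ω(p₁, ·) ⊗ p₁] ≠ 0` for some `p₁ ∈ P`. (Otherwise every `p₁ ∈ P` is an eigenvector of `Y`,
`ω(q, p₁) Y p₁ = ω(Y q, p₁) p₁ = −ω(q, Y p₁) p₁`, with eigenvalue `c` satisfying `2c = 0`; so `Y|_P = 0`, and
`Y|_Q = 0` by duality.) [cite: GoodmanWallachGTM255, §2.1.2] [cite: Humphreys1972, §1.2] -/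
theorem SymplecticIdeal.exists_plus_of_levi (ω : LinearMap.BilinForm ℂ M) (hωnd : ω.Nondegenerate)
    (hωalt : ∀ x y, ω x y = -ω y x) {T : Module.End ℂ M} (hTskew : ∀ x y, ω (T x) y + ω x (T y) = 0)
    {P Q : Submodule ℂ M} (hP : ∀ x ∈ P, T x = x) (hQ : ∀ x ∈ Q, T x = -x)
    (hPmem : ∀ v, (2 : ℂ)⁻¹ • (v + T v) ∈ P) (hQmem : ∀ v, (2 : ℂ)⁻¹ • (v - T v) ∈ Q)
    {Y : Module.End ℂ M} (hYskew : ∀ x y, ω (Y x) y + ω x (Y y) = 0)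
    (hYQ : ∀ q ∈ Q, Y q ∈ Q) (hY0 : Y ≠ 0) :
    ∃ p₁ ∈ P, Y * (ω p₁).smulRight p₁ - (ω p₁).smulRight p₁ * Y ≠ 0 := by
  have hdetP : ∀ x ∈ P, (∀ q ∈ Q, ω x q = 0) → x = 0 :=
    fun x hx hxQ => SymplecticIdeal.eq_zero_of_forall_Q ω hωnd hTskew hP hPmem hQmem hx hxQ
  have hdetQ : ∀ y ∈ Q, (∀ p ∈ P, ω p y = 0) → y = 0 :=
    fun y hy hyP => SymplecticIdeal.eq_zero_of_forall_P ω hωnd hωalt hTskew hQ hPmem hQmem hy hyP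
  by_contra hcon
  push Not at hcon
  -- every `p₁ ∈ P` is killed by `Y`
  have hYP0 : ∀ p₁ ∈ P, Y p₁ = 0 := by
    intro p₁ hp₁
    by_cases hp₁0 : p₁ = 0
    · rw [hp₁0, map_zero]
    -- a dual vector `q₁ ∈ Q` with `ω(p₁, q₁) ≠ 0`
    obtain ⟨q₁, hq₁, hq₁ne⟩ : ∃ q₁ ∈ Q, ω p₁ q₁ ≠ 0 := by
      by_contra h
      push Not at h
      exact hp₁0 (hdetP p₁ hp₁ h)
    -- the vanishing bracket evaluated at `q₁`
    have hev : ∀ q ∈ Q, ω p₁ q • Y p₁ = ω p₁ (Y q) • p₁ := by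
      intro q hq
      have h := congrArg (fun f : Module.End ℂ M => f q) (hcon p₁ hp₁)
      simp only [LinearMap.zero_apply, LinearMap.sub_apply, Module.End.mul_apply, LinearMap.smulRight_apply,
        map_smul, sub_eq_zero] at h
      exact h
    -- `Y p₁ = c • p₁`
    set c : ℂ := (ω p₁ q₁)⁻¹ * ω p₁ (Y q₁) with hc
    have hYp₁ : Y p₁ = c • p₁ := by
      have h := hev q₁ hq₁
      have h' := congrArg (fun x => (ω p₁ q₁)⁻¹ • x) h
      simp only [smul_smul, inv_mul_cancel₀ hq₁ne, one_smul] at h'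
      rw [h', hc]
    -- and `c = 0`: `ω(p₁, Y q₁) = -ω(Y p₁, q₁) = -c ω(p₁, q₁)`
    have hc0 : c = 0 := by
      have h1 : ω p₁ (Y q₁) = -(c * ω p₁ q₁) := by
        have h := hYskew p₁ q₁
        rw [hYp₁, map_smul, LinearMap.smul_apply, smul_eq_mul] at h
        linear_combination h
      have h2 : c * ω p₁ q₁ = ω p₁ (Y q₁) := by
        rw [hc, mul_comm, ← mul_assoc, mul_inv_cancel₀ hq₁ne, one_mul]
      have h3 : (2 : ℂ) * (c * ω p₁ q₁) = 0 := by linear_combination h2 + h1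
      rcases mul_eq_zero.1 h3 with h4 | h4
      · exact absurd h4 two_ne_zero
      · exact (mul_eq_zero.1 h4).resolve_right hq₁ne
    rw [hYp₁, hc0, zero_smul]
  -- hence `Y|_Q = 0` by duality, and `Y = 0`
  have hYQ0 : ∀ q ∈ Q, Y q = 0 := by
    intro q hq
    refine hdetQ _ (hYQ q hq) fun p hp => ?_
    have h := hYskew p q
    rw [hYP0 p hp, map_zero, LinearMap.zero_apply, zero_add] at h
    exact h
  apply hY0
  apply LinearMap.ext
  intro v
  have hv : (2 : ℂ)⁻¹ • (v + T v) + (2 : ℂ)⁻¹ • (v - T v) = v := by module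
  rw [LinearMap.zero_apply, ← hv, map_add, hYP0 _ (hPmem v), hYQ0 _ (hQmem v), add_zero]

/-! ### §4 The theorem: a non-zero ideal of `𝔰𝔭(M, ω)` contains `T` -/

/-- **Theorem (the Lagrangian grading operator lies in every non-zero ideal of `𝔰𝔭(M, ω)`).** Let `ω` be a
nondegenerate alternating form on a finite-dimensional complex space `M`, `T` an `ω`-skew involution with
eigenspaces `P`, `Q`, and `I ⊆ End(M)` a non-zero `ℂ`-subspace of `ω`-skew operators such that `[Z, Y] ∈ I`
for every `ω`-skew `Z` and every `Y ∈ I`. Then `T ∈ I`. (Grade a non-zero `Y ∈ I` under `ad T`; its three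
components lie in `I`; a non-zero component in `𝔲^±` gives `±T ∈ I` by §3, and a Levi `Y` produces a non-zero
element of `I ∩ 𝔲⁺`.) This is the mechanism of «`𝔰𝔭_{2g}(ℂ)` is simple» in the form used by Hazama's Goursat
argument for `Hg(X₁ × X₂)`. [cite: GoodmanWallachGTM255, §2.1.2 and §2.5.3] [cite: Humphreys1972, §1.2 and §19.1]
[cite: MoonenZarhin1999LowDim, §3 (3.1)] -/
theorem SymplecticIdeal.theta_mem_of_ne_bot [FiniteDimensional ℂ M] (ω : LinearMap.BilinForm ℂ M)
    (hωnd : ω.Nondegenerate) (hωalt : ∀ x y, ω x y = -ω y x) {T : Module.End ℂ M} (hTT : ∀ v, T (T v) = v)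
    (hTskew : ∀ x y, ω (T x) y + ω x (T y) = 0) {P Q : Submodule ℂ M}
    (hP : ∀ x ∈ P, T x = x) (hQ : ∀ x ∈ Q, T x = -x) (hPmem : ∀ v, (2 : ℂ)⁻¹ • (v + T v) ∈ P)
    (hQmem : ∀ v, (2 : ℂ)⁻¹ • (v - T v) ∈ Q) (I : Submodule ℂ (Module.End ℂ M))
    (hIskew : ∀ Y ∈ I, ∀ x y, ω (Y x) y + ω x (Y y) = 0)
    (hI : ∀ Z : Module.End ℂ M, (∀ x y, ω (Z x) y + ω x (Z y) = 0) → ∀ Y ∈ I, Z * Y - Y * Z ∈ I)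
    (hI0 : I ≠ ⊥) : T ∈ I := by
  obtain ⟨Y, hYI, hY0⟩ := (Submodule.ne_bot_iff I).1 hI0
  have hYskew := hIskew Y hYI
  have hTfix : ∀ x, T x = x → x ∈ P := fun x hx => by
    have h := hPmem x
    rwa [hx, ← two_smul ℂ x, smul_smul, inv_mul_cancel₀ (two_ne_zero' ℂ), one_smul] at h
  have hTneg : ∀ x, T x = -x → x ∈ Q := fun x hx => by
    have h := hQmem x
    rwa [hx, sub_neg_eq_add, ← two_smul ℂ x, smul_smul, inv_mul_cancel₀ (two_ne_zero' ℂ), one_smul] at h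
  have hT2 : T * T = 1 := LinearMap.ext fun v => by rw [Module.End.mul_apply, hTT, Module.End.one_apply]
  -- data for `-T`
  have hnTT : ∀ v, (-T) ((-T) v) = v := fun v => by
    rw [LinearMap.neg_apply, LinearMap.neg_apply, map_neg, neg_neg, hTT]
  have hnTskew : ∀ x y, ω ((-T) x) y + ω x ((-T) y) = 0 := fun x y => by
    rw [LinearMap.neg_apply, LinearMap.neg_apply, map_neg, LinearMap.neg_apply, map_neg, ← neg_add, hTskew,
      neg_zero]
  have hP' : ∀ x ∈ Q, (-T) x = x := fun x hx => by rw [LinearMap.neg_apply, hQ x hx, neg_neg]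
  have hQ' : ∀ x ∈ P, (-T) x = -x := fun x hx => by rw [LinearMap.neg_apply, hP x hx]
  have hPmem' : ∀ v, (2 : ℂ)⁻¹ • (v + (-T) v) ∈ Q := fun v => by
    rw [LinearMap.neg_apply, ← sub_eq_add_neg]; exact hQmem v
  have hQmem' : ∀ v, (2 : ℂ)⁻¹ • (v - (-T) v) ∈ P := fun v => by
    rw [LinearMap.neg_apply, sub_neg_eq_add]; exact hPmem v
  -- the raising components `Y₊ = ¼(Y + TY - YT - TYT)`, `Y₋` (for `-T`) lie in `I`
  have hraise : ∀ {S : Module.End ℂ M}, (∀ v, S (S v) = v) → (∀ x y, ω (S x) y + ω x (S y) = 0) →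
      (4 : ℂ)⁻¹ • (Y + S * Y - Y * S - S * Y * S) ∈ I := by
    intro S hSS hSskew
    have hS2 : S * S = 1 := LinearMap.ext fun v => by rw [Module.End.mul_apply, hSS, Module.End.one_apply]
    have h1 : S * Y - Y * S ∈ I := hI S hSskew Y hYI
    have h2 : S * (S * Y - Y * S) - (S * Y - Y * S) * S ∈ I := hI S hSskew _ h1
    have h2' : S * (S * Y - Y * S) - (S * Y - Y * S) * S = (2 : ℂ) • Y - (2 : ℂ) • (S * Y * S) := by
      rw [mul_sub, sub_mul, ← mul_assoc, hS2, one_mul, mul_assoc Y S S, hS2, mul_one, ← mul_assoc]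
      module
    have h : (4 : ℂ)⁻¹ • (Y + S * Y - Y * S - S * Y * S) =
        (8 : ℂ)⁻¹ • (S * (S * Y - Y * S) - (S * Y - Y * S) * S) + (4 : ℂ)⁻¹ • (S * Y - Y * S) := by
      rw [h2']
      module
    rw [h]
    exact Submodule.add_mem _ (Submodule.smul_mem _ _ h2) (Submodule.smul_mem _ _ h1)
  set Yp := (4 : ℂ)⁻¹ • (Y + T * Y - Y * T - T * Y * T) with hYp
  set Ym := (4 : ℂ)⁻¹ • (Y + (-T) * Y - Y * (-T) - (-T) * Y * (-T)) with hYm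
  have hYpI : Yp ∈ I := hraise hTT hTskew
  have hYmI : Ym ∈ I := hraise hnTT hnTskew
  have hYpP : ∀ p ∈ P, Yp p = 0 := fun p hp => UnitaryTheta.raise_apply_of_eq T Y (hP p hp)
  have hYpim : ∀ v, Yp v ∈ P := fun v => hTfix _ (UnitaryTheta.apply_raise_apply hTT Y v)
  have hYmQ : ∀ q ∈ Q, Ym q = 0 := fun q hq =>
    UnitaryTheta.raise_apply_of_eq (-T) Y (by rw [LinearMap.neg_apply, hQ q hq, neg_neg])
  have hYmim : ∀ v, Ym v ∈ Q := fun v => by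
    refine hTneg _ ?_
    have h := UnitaryTheta.apply_raise_apply hnTT Y v
    rw [LinearMap.neg_apply, neg_eq_iff_eq_neg] at h
    exact h
  by_cases hp0 : Yp = 0
  swap
  · exact SymplecticIdeal.theta_mem_of_plus ω hωnd hωalt hTskew hP hQ hPmem hQmem I hI hYpI (hIskew _ hYpI)
      hYpP hYpim hp0
  by_cases hm0 : Ym = 0
  swap
  · have h := SymplecticIdeal.theta_mem_of_plus ω hωnd hωalt hnTskew hP' hQ' hPmem' hQmem' I hI hYmI
      (hIskew _ hYmI) hYmQ hYmim hm0
    exact (Submodule.neg_mem_iff _).1 h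
  -- the Levi case: `Y = Y₀` preserves `P` and `Q`
  have hYmP : ∀ p ∈ P, Ym p = (2 : ℂ)⁻¹ • (Y p - T (Y p)) := fun p hp => by
    have h := UnitaryTheta.raise_apply_of_eq_neg (-T) Y (ℓ := p) (by rw [LinearMap.neg_apply, hP p hp])
    rw [hYm, h, LinearMap.neg_apply, ← sub_eq_add_neg]
  have hYpQ : ∀ q ∈ Q, Yp q = (2 : ℂ)⁻¹ • (Y q + T (Y q)) := fun q hq =>
    UnitaryTheta.raise_apply_of_eq_neg T Y (hQ q hq)
  have hYP : ∀ p ∈ P, Y p ∈ P := by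
    intro p hp
    have h1 := hYmP p hp
    rw [hm0, LinearMap.zero_apply] at h1
    -- `Y p - T (Y p) = 0`, so `Y p` is `T`-fixed
    have h2 : T (Y p) = Y p := by
      have h3 : (2 : ℂ)⁻¹ • (Y p - T (Y p)) = 0 := h1.symm
      rw [smul_eq_zero] at h3
      exact (sub_eq_zero.1 (h3.resolve_left (inv_ne_zero (two_ne_zero' ℂ)))).symm
    exact hTfix _ h2
  have hYQ : ∀ q ∈ Q, Y q ∈ Q := by
    intro q hq
    have h1 := hYpQ q hq
    rw [hp0, LinearMap.zero_apply] at h1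
    have h2 : T (Y q) = -Y q := by
      have h3 : (2 : ℂ)⁻¹ • (Y q + T (Y q)) = 0 := h1.symm
      rw [smul_eq_zero] at h3
      exact eq_neg_of_add_eq_zero_right (h3.resolve_left (inv_ne_zero (two_ne_zero' ℂ)))
    exact hTneg _ h2
  obtain ⟨p₁, hp₁, hne⟩ := SymplecticIdeal.exists_plus_of_levi ω hωnd hωalt hTskew hP hQ hPmem hQmem hYskew
    hYQ hY0
  have hPP := SymplecticIdeal.isotropic_of_skew_involution ω hTskew hP
  -- `Z = [Y, ω(p₁,·) ⊗ p₁] ∈ I ∩ 𝔲⁺`, non-zero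
  set B' : Module.End ℂ M := (ω p₁).smulRight p₁ with hB'
  have hB'skew := SymplecticIdeal.smulRight_self_skew ω hωalt p₁
  have hZI : Y * B' - B' * Y ∈ I := by
    have h := hI _ hB'skew Y hYI
    rw [← neg_sub] at h
    exact (Submodule.neg_mem_iff _).1 h
  have hB'P : ∀ p ∈ P, B' p = 0 := fun p hp => by
    rw [hB', LinearMap.smulRight_apply, hPP p₁ hp₁ p hp, zero_smul]
  have hB'im : ∀ v, B' v ∈ P := fun v => by
    rw [hB', LinearMap.smulRight_apply]; exact Submodule.smul_mem _ _ hp₁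
  have hZP : ∀ p ∈ P, (Y * B' - B' * Y) p = 0 := fun p hp => by
    rw [LinearMap.sub_apply, Module.End.mul_apply, Module.End.mul_apply, hB'P p hp, map_zero,
      hB'P _ (hYP p hp), sub_zero]
  have hZim : ∀ v, (Y * B' - B' * Y) v ∈ P := fun v => by
    rw [LinearMap.sub_apply, Module.End.mul_apply, Module.End.mul_apply]
    exact Submodule.sub_mem _ (hYP _ (hB'im v)) (hB'im _)
  exact SymplecticIdeal.theta_mem_of_plus ω hωnd hωalt hTskew hP hQ hPmem hQmem I hI hZI (hIskew _ hZI)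
    hZP hZim hne

end PairOps

/-! ### §5 The Hodge form: a non-zero `𝔰𝔭(V_ℂ, ψ_ℂ)`-ideal of skew operators contains `Θ` -/

section Hodge

universe u

variable {V : Type u} [AddCommGroup V] [Module ℚ V] [Module.Finite ℚ V] [HodgeTensorFacts.{u, u}] {n : ℤ}

/-- **Hodge form of the ideal theorem.** Let `H` be an effective polarized weight-one `ℚ`-Hodge structure on `V`
with polarization `ψ` and Hodge operator `Θ` (`+1` on `V^{1,0}`, `−1` on `V^{0,1}`). If `I ⊆ End(V_ℂ)` is a
non-zero `ℂ`-subspace of `ψ_ℂ`-skew operators such that `[Z, Y] ∈ I` for every `ψ_ℂ`-skew `Z` and every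
`Y ∈ I`, then `Θ ∈ I`. (`Θ` is a `ψ_ℂ`-skew involution whose eigenspaces `V^{1,0}`, `V^{0,1}` are the Lagrangian
pair of §1–§4: `UnitaryTheta.theta_facts`, `formBaseChange_skew_of_mem_hodgeLieC`.) Used with
`I = (𝔞 ∩ ker c₁)|_{H¹(X₂)} ⊗ ℂ` in the product theorem for `X₁ × X₂` (Hazama / Moonen–Zarhin (3.2)(1)).
[cite: MoonenZarhin1999LowDim, §3 (3.1) and Thm. (3.2)(1)] [cite: GoodmanWallachGTM255, §2.1.2]
[cite: VoisinHodgeI2002, §7.1.2 Def. 7.7] -/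
theorem SymplecticIdeal.theta_mem_of_ne_bot_hodge (H : HodgeStructure V n) (hn : n = 1) (heff : H.IsEffective)
    (ψ : H.Polarization) {Θ : Module.End ℂ (ℂ ⊗[ℚ] V)}
    (hΘ : ∀ p, ∀ x ∈ H.piece p (n - p), Θ x = ((2 * p - n : ℤ) : ℂ) • x)
    (I : Submodule ℂ (Module.End ℂ (ℂ ⊗[ℚ] V)))
    (hIskew : ∀ Y ∈ I, ∀ x y, ψ.form.baseChange ℂ (Y x) y + ψ.form.baseChange ℂ x (Y y) = 0)
    (hI : ∀ Z : Module.End ℂ (ℂ ⊗[ℚ] V),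
      (∀ x y, ψ.form.baseChange ℂ (Z x) y + ψ.form.baseChange ℂ x (Z y) = 0) → ∀ Y ∈ I, Z * Y - Y * Z ∈ I)
    (hI0 : I ≠ ⊥) : Θ ∈ I := by
  have hΘC : Θ ∈ H.hodgeLieC := H.mem_hodgeLieC_of_forall_piece hΘ
  subst hn
  obtain ⟨hP, hQ, hΘ10, hΘ01, hΘΘ⟩ := UnitaryTheta.theta_facts H rfl heff hΘ
  set ω := ψ.form.baseChange ℂ with hω
  have hωnd : ω.Nondegenerate := ψ.nondegenerate_baseChange
  have hωalt : ∀ x y, ω x y = -ω y x := fun x y => by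
    rw [hω, ψ.form_baseChange_swap y x, Int.negOnePow_odd 1 odd_one]
    norm_num
  have hΘskew : ∀ x y, ω (Θ x) y + ω x (Θ y) = 0 := fun x y => by
    rw [hω, formBaseChange_skew_of_mem_hodgeLieC ψ hΘC x y, neg_add_cancel]
  exact SymplecticIdeal.theta_mem_of_ne_bot ω hωnd hωalt hΘΘ hΘskew (P := H.piece 1 0) (Q := H.piece 0 1)
    hΘ10 hΘ01 hP hQ I hIskew hI hI0

end Hodge

end HodgeStructure

end Literature.AlgebraicGeometry.Motives

end
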